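import Mathlib.MeasureTheory.Group.Integral
import Literature.Analysis.FluidPDE.NSBoundedMildOseen
import Literature.Analysis.UnboundedOperators.HeatKernelBoundedData
import HarnessLib

/-!
# KNSS 2009, Remark 6.1: an ancient mild solution of the form `b(t)` is constant (proved), and
# the oddness of the Oseen kernel

Analysis/FluidPDE support file (all results proved) for the decomposition of
`Literature.Analysis.FluidPDE.KNSS2009_regularity_typeI_rate` (Koch–Nadirashvili–Seregin–Šverák,
Acta Math. 203 (2009) = arXiv:0709.3599, Theorem 6.2; `KNSSTypeIRate`). Step 5 of the printed
proof of Theorem 6.2 (arXiv p. 13) applies, to the planar part `(w₁, w₃)` of the blow-up limit,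
Theorem 5.1 (`(w₁, w₃)(x, t) = b(t)`) and then

> **Remark 6.1** (arXiv p. 11). "A bounded ancient mild solution `u(x, t)` of the Navier–Stokes
> equations which is of the form `u(x, t) = b(t)` is constant (independent of `t`). We leave
> the proof of the last statement to the reader as a simple exercise."

Here "mild" is KNSS's notion (§4 (i), p. 8, with §3, p. 6): the representation formula
`u(t) = Γ(t − s) ∗ u(s) + ∫ₛᵗ∫ K(x − y, t − τ) f(y, τ) dy dτ` with `f_{jk} = −u_k u_j`, i.e. the
**Oseen integral equation** `u(t) = e^{ν(t−s)Δ} u(s) − B^ν_s(u, u)(t)` of the tree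
(`NSBoundedMildOseen`: `UnboundedOperators.heatExtension`, `oseenDuhamel`, kernel `oseenKernel` of
`KochTataru`). (In the tree's *duality-form* classes `IsMildNSSolutionOn`,
`IsBoundedAncientMildSolution` the remark is false: they do not see spatial constants, cf.
`isBoundedAncientMildSolution_fun_const`.) This file proves the exercise in that rendering:

* `oseenWeightA_neg`, `oseenWeightB_neg`, `oseenKernel_neg`: the Oseen kernel is **odd** in
  the space variable, `K(τ, −z)[a, b] = −K(τ, z)[a, b]` (its closed Gaussian form, Koch–Tataru
  2001, (8), carries an odd number of factors `z`);
* `integral_oseenKernel_eq_zero`, `integral_oseenKernel_sub_left_eq_zero`: hence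
  `∫ K(τ, z)[a, b] dz = 0` and `∫ K(τ, x − y)[a, b] dy = 0` — unconditionally, both sides of
  `∫ f(−z) dz = ∫ f(z) dz` being equal whether or not `f` is integrable;
* `oseenDuhamel_eq_zero_of_const`: `B^ν_s(u, v)(t) = 0` when `u`, `v` are spatially constant on
  `(s, t)` (`e^{σΔ} P ∇·` kills constant tensors);
* `KNSS2009_remark61`: if `u(t, x) = b(t)` for `t < 0` and `u` satisfies the Oseen integral
  equation between all times `s < t < 0` (a.e. in `x`), then `b` is constant on `(−∞, 0)` —
  `b(t) = e^{ν(t−s)Δ} b(s) − 0 = b(s)` (`UnboundedOperators.heatExtension_const`).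

## References

* G. Koch, N. Nadirashvili, G. Seregin, V. Šverák, Acta Math. 203 (2009) 83–105 =
  arXiv:0709.3599: Remark 6.1, p. 11; §3, p. 6 and §4 (i), p. 8 (mild solutions); proof of
  Theorem 6.2, p. 13 (the use of the remark). [KochNadirashviliSereginSverak2009]
* H. Koch, D. Tataru, Adv. Math. 157 (2001), §2 (8) (the kernel). [KochTataruAdvMath2001]
-/

noncomputable section

open MeasureTheory Set Function Filter
open scoped RealInnerProductSpace

namespace Literature.Analysis.FluidPDE

variable {E : Type*} [NormedAddCommGroup E] [InnerProductSpace ℝ E] [FiniteDimensional ℝ E]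
  [MeasurableSpace E] [BorelSpace E]

/-! ### The Oseen kernel is odd in the space variable -/

omit [FiniteDimensional ℝ E] [MeasurableSpace E] [BorelSpace E] in
/-- The first Gaussian weight is even: `A(τ, −z) = A(τ, z)` (the heat kernel is even). [folklore] -/
theorem oseenWeightA_neg (τ : ℝ) (z : E) : oseenWeightA τ (-z) = oseenWeightA τ z := by
  simp [oseenWeightA, UnboundedOperators.heatKernel_neg]

omit [FiniteDimensional ℝ E] [MeasurableSpace E] [BorelSpace E] in
/-- The second Gaussian weight is even: `B(τ, −z) = B(τ, z)`. [folklore] -/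
theorem oseenWeightB_neg (τ : ℝ) (z : E) : oseenWeightB τ (-z) = oseenWeightB τ z := by
  simp [oseenWeightB, UnboundedOperators.heatKernel_neg]

omit [FiniteDimensional ℝ E] [MeasurableSpace E] [BorelSpace E] in
/-- **The Oseen kernel is odd in `z`**: `K(τ, −z)[a, b] = −K(τ, z)[a, b]` (each term of the closed
Gaussian form of Koch–Tataru 2001, (8), carries an odd number of factors `z` or `⟪z, ·⟫`, the
Gaussian weights being even). [cite: KochTataruAdvMath2001, §2 (8)] -/
theorem oseenKernel_neg (τ : ℝ) (z a b : E) : oseenKernel τ (-z) a b = -oseenKernel τ z a b := by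
  simp only [oseenKernel, oseenWeightA_neg, oseenWeightB_neg, UnboundedOperators.heatKernel_neg,
    inner_neg_left, neg_mul, neg_neg, mul_neg, neg_div, smul_neg, neg_smul]
  module

/-- **The Oseen kernel has integral zero in `z`**: `∫ K(τ, z)[a, b] dz = 0` for every `τ, a, b`
(oddness and `∫ f(−z) dz = ∫ f(z) dz`; no integrability is needed, the two sides of the latter
identity being junk together). This is `e^{τΔ} P ∇· (a ⊗ b) = 0` for the constant tensor. [folklore] -/
theorem integral_oseenKernel_eq_zero (τ : ℝ) (a b : E) :
    ∫ z, oseenKernel τ z a b = 0 := by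
  have h := integral_neg_eq_self (fun z => oseenKernel τ z a b) (volume : Measure E)
  simp only [oseenKernel_neg, integral_neg] at h
  -- `-I = I` forces `I = 0`
  have h2 : (2 : ℝ) • ∫ z, oseenKernel τ z a b = 0 := by
    rw [two_smul]
    nth_rewrite 1 [← h]
    exact neg_add_cancel _
  exact (smul_eq_zero.1 h2).resolve_left two_ne_zero

/-- Translated form: `∫ K(τ, x − y)[a, b] dy = 0` for every `τ, x, a, b`. [folklore] -/
theorem integral_oseenKernel_sub_left_eq_zero (τ : ℝ) (x a b : E) :
    ∫ y, oseenKernel τ (x - y) a b = 0 := by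
  rw [integral_sub_left_eq_self (fun z => oseenKernel τ z a b) (volume : Measure E) x]
  exact integral_oseenKernel_eq_zero τ a b

/-! ### The Duhamel term of spatially constant fields vanishes -/

/-- **`B^ν_s(u, v)(t) = 0` for spatially constant fields**: if `u(τ, ·) = b(τ)` and
`v(τ, ·) = c(τ)` are constant in space for `τ ∈ (s, t)`, then `oseenDuhamel ν s u v t x = 0` for
every `x` (the inner integral is `∫ K(ν(t − τ), x − y)[b(τ), c(τ)] dy = 0` for each `τ`;
KNSS 2009, §4: `B` involves only spatial derivatives of `u ⊗ v`). [cite: KochNadirashviliSereginSverak2009, §4 p. 8 (arXiv:0709.3599)] -/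
theorem oseenDuhamel_eq_zero_of_const {ν s t : ℝ} {u v : ℝ → E → E} {b c : ℝ → E}
    (hu : ∀ τ ∈ Ioo s t, ∀ y, u τ y = b τ) (hv : ∀ τ ∈ Ioo s t, ∀ y, v τ y = c τ) (x : E) :
    oseenDuhamel ν s u v t x = 0 := by
  rw [oseenDuhamel_apply]
  refine setIntegral_eq_zero_of_forall_eq_zero fun τ hτ => ?_
  have e : (fun y => oseenKernel (ν * (t - τ)) (x - y) (u τ y) (v τ y)) =
      fun y => oseenKernel (ν * (t - τ)) (x - y) (b τ) (c τ) :=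
    funext fun y => by rw [hu τ hτ y, hv τ hτ y]
  rw [e]
  exact integral_oseenKernel_sub_left_eq_zero _ x _ _

/-! ### Remark 6.1 -/

/-- **KNSS 2009, Remark 6.1** (Acta Math. 203 (2009) = arXiv:0709.3599, p. 11: "A bounded
ancient mild solution `u(x, t)` of the Navier–Stokes equations which is of the form
`u(x, t) = b(t)` is constant (independent of `t`). We leave the proof of the last statement to
the reader as a simple exercise."), in the rendering of KNSS's mild solutions by the Oseen
integral equation (module docstring). **Statement.** Let `ν > 0`, let `u : ℝ → E → E` be of the
form `u(t, x) = b(t)` for `t < 0`, and suppose that between all times `s < t < 0` the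
representation formula `u(t) = e^{ν(t−s)Δ} u(s) − B^ν_s(u, u)(t)` holds almost everywhere in
`x` (`UnboundedOperators.heatExtension`, `oseenDuhamel`). Then `b(s) = b(t)` for all `s, t < 0`.
Proof: `B^ν_s(u, u)(t) = 0` (`oseenDuhamel_eq_zero_of_const`) and `e^{σΔ} b(s) = b(s)`
(`heatExtension_const`), so the formula reads `b(t) = b(s)` at almost every, hence at some,
point. (Boundedness and measurability, part of KNSS's class, are not needed for the conclusion.) [cite: KochNadirashviliSereginSverak2009, Remark 6.1 (arXiv p. 11)] -/
theorem KNSS2009_remark61 {ν : ℝ} (hν : 0 < ν) {u : ℝ → E → E} {b : ℝ → E}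
    (hub : ∀ t < 0, ∀ x, u t x = b t)
    (hmild : ∀ s t : ℝ, s < t → t < 0 → ∀ᵐ x ∂(volume : Measure E),
      u t x = UnboundedOperators.heatExtension (u s) (ν * (t - s)) x - oseenDuhamel ν s u u t x) :
    ∀ s t : ℝ, s < 0 → t < 0 → b s = b t := by
  -- the ordered case
  have key : ∀ s t : ℝ, s < t → t < 0 → b s = b t := by
    intro s t hst ht
    have hs : s < 0 := hst.trans ht
    have hσ : 0 < ν * (t - s) := mul_pos hν (by linarith)
    have hus : u s = fun _ => b s := funext (hub s hs)
    have hD : ∀ x, oseenDuhamel ν s u u t x = 0 := fun x =>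
      oseenDuhamel_eq_zero_of_const (fun τ hτ y => hub τ (hτ.2.trans ht) y)
        (fun τ hτ y => hub τ (hτ.2.trans ht) y) x
    obtain ⟨x, hx⟩ := (hmild s t hst ht).exists
    rw [hub t ht x, hus, UnboundedOperators.heatExtension_const (b s) hσ x, hD x, sub_zero] at hx
    exact hx.symm
  intro s t hs ht
  rcases lt_trichotomy s t with h | h | h
  · exact key s t h ht
  · rw [h]
  · exact (key t s h hs).symm

end Literature.Analysis.FluidPDE

end
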